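import Summits.AtomisticToContinuum.FouriersLaw.Theorems.PhononMeanFreePathCoherentDephasingFluxAttenuation
import Summits.AtomisticToContinuum.FouriersLaw.Theorems.PhononMeanFreePathCoherentDephasingHeadBound

/-!
# `CoherentDephasing` from a BULK coherent-flux attenuation bound and a CONTACT bound (line `Sketch`, crux stmt-AtomisticToContinuum-11810)

Full-bond-force variant of the flux-form Beer–Lambert glue `…CoherentDephasing.FluxAttenuation` for line `Sketch`
(coherent-field Beer–Lambert) of the crux `PhononMeanFreePath.CoherentDephasing`. For the `(N+1)`-site pinned
anharmonic chain (Langevin baths at sites `0` and `N`) write `J_b = cohFlux … N b = -∫₀^∞ m_{b+1} F_b` for the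
time-integrated COHERENT energy flux through bond `b` (full bond force, anharmonic part included) of the Gibbs-averaged
linear response to a momentum kick at site `0`, and `D_N = γ∫₀^∞ m_N²` for the far-bath dissipation. Hypothesis (i) is
the bulk block attenuation bound on the POSITIVE PART of the incoming flux, stated directly as a flux DECREMENT:
`κ · max(J_{x-1}, 0) ≤ J_{x-1} - J_{x+L₀-1}` (`κ > 0`) for every BULK block `x, …, x+L₀-1` (`1 ≤ x`, `L ≤ x`,
`x + L₀ + K ≤ N`, `N ≥ N₀`); hypothesis (ii) is the CONTACT bound `D_N ≤ (1+C) · max(J_{N-K-1}, 0)`.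

Proof. No site balances are needed in this attribution: tile the bulk sites `a, …, M` (`M = N-K-1`) by `n` blocks
of `L₀` sites and read hypothesis (i) at the block starting at `x = a + jL₀` as a one-step contraction of the positive
parts of the block-boundary fluxes `F_j = J_{a+jL₀-1}`: `F_{j+1} ≤ F_j - κ max(F_j,0) ≤ (1 - min κ 1) max(F_j,0)`
(case on the sign of `F_j`), so `max(F_{j+1},0) ≤ θ max(F_j,0)` with `θ = 1 - min κ 1 ∈ [0,1)`;
`max_le_geometric_of_step` (from `…FluxAttenuation`) iterates it to `max(J_M,0) ≤ max(B,0) θ^n` with `J ≤ B` the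
landed `N`-uniform coherent-flux bound `HeadBound.cohFlux_le_uniform`, and `D_N ≤ (1+C) max(B,0) θ^n`
(`dissipation_le_geometric_posFluxDecrement`). The reduction concludes `N ∫₀^∞ m_N² → 0` by `N θ^{(N-c)/L₀} → 0`
(`…Telescoping.tendsto_natMul_pow_div`), the integrability clause coming from `pairCorr_sq_integrableOn`.
-/

noncomputable section

open MeasureTheory Set Filter Topology

namespace Summit.AtomisticToContinuum.FouriersLaw.Theorems.CoherentDephasing.CohFluxAttenuation

open Literature.MathematicalPhysics.KineticTheory.HeatConduction (pinnedChain PhaseSpace)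
open Summit.AtomisticToContinuum.FouriersLaw.Theses.PhononMeanFreePath (CoherentDephasing)
open Summit.AtomisticToContinuum.FouriersLaw.Theorems.PhononMeanFreePath
open Summit.AtomisticToContinuum.FouriersLaw.Theorems.CoherentDephasing.Telescoping (tendsto_natMul_pow_div)
open Summit.AtomisticToContinuum.FouriersLaw.Theorems.CoherentDephasing.FluxAttenuation (max_le_geometric_of_step)
open Summit.AtomisticToContinuum.FouriersLaw.Theorems.CoherentDephasing.HeadBound (cohFlux_le_uniform)

/-! ## Abstract part: geometric decay from a positive-part flux decrement on consecutive blocks -/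

/-- **Geometric decay of the coherent flux from a BULK positive-part flux decrement and a contact bound** (abstract
core). `J : ℕ → ℝ` (flux through bond `b`); the bulk sites `a, …, M` are tiled by `n` blocks of `L₀` sites,
`a + n L₀ = M + 1`. Assume on each of the `n` blocks the decrement bound
`κ max(J (a + jL₀ - 1), 0) ≤ J (a + jL₀ - 1) - J (a + jL₀ + L₀ - 1)` (`κ > 0`), the head bound `J (a-1) ≤ B` and the
contact bound `D ≤ (1+C) max(J M, 0)` (`C ≥ 0`). Then `D ≤ (1+C) · max(B,0) · (1 - min κ 1)^n`. [folklore] -/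
theorem dissipation_le_geometric_posFluxDecrement (J : ℕ → ℝ) (D B κ C : ℝ) (M a L₀ n : ℕ) (hκ : 0 < κ)
    (hC : 0 ≤ C) (htile : a + n * L₀ = M + 1)
    (hatt : ∀ j, j < n →
      κ * max (J (a + j * L₀ - 1)) 0 ≤ J (a + j * L₀ - 1) - J (a + j * L₀ + L₀ - 1))
    (hhead : J (a - 1) ≤ B) (hD : D ≤ (1 + C) * max (J M) 0) :
    D ≤ (1 + C) * max B 0 * (1 - min κ 1) ^ n := by
  set θ : ℝ := 1 - min κ 1 with hθdef
  have hθ0 : 0 ≤ θ := by rw [hθdef]; linarith [min_le_right κ 1]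
  have hm0 : 0 ≤ min κ 1 := (lt_min hκ one_pos).le
  -- one-step contraction of the positive parts of the boundary fluxes `F j = J (a + jL₀ - 1)`
  have hstep : ∀ j, j < n → max (J (a + (j + 1) * L₀ - 1)) 0 ≤ θ * max (J (a + j * L₀ - 1)) 0 := by
    intro j hjn
    have h2 := hatt j hjn
    have e : a + (j + 1) * L₀ - 1 = a + j * L₀ + L₀ - 1 := by rw [Nat.succ_mul]; omega
    rw [e]
    refine max_le ?_ (mul_nonneg hθ0 (le_max_right _ _))
    rcases le_or_gt 0 (J (a + j * L₀ - 1)) with hJ | hJ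
    · -- non-negative incoming flux: `F (j+1) ≤ (1-κ) F j ≤ (1 - min κ 1) F j`
      rw [max_eq_left hJ] at h2 ⊢
      have h3 : min κ 1 * J (a + j * L₀ - 1) ≤ κ * J (a + j * L₀ - 1) :=
        mul_le_mul_of_nonneg_right (min_le_left κ 1) hJ
      rw [hθdef]
      linarith
    · -- negative incoming flux: the block is passive, `F (j+1) ≤ F j < 0`
      rw [max_eq_right hJ.le] at h2 ⊢
      rw [mul_zero] at h2 ⊢
      linarith
  -- geometric decay of the positive parts down to the last bulk bond `M = a + nL₀ - 1`
  have hend : max (J M) 0 ≤ max B 0 * θ ^ n := by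
    have h := max_le_geometric_of_step (fun j => J (a + j * L₀ - 1)) B θ n hθ0 (fun j hj => hstep j hj)
      (by simpa using hhead)
    have e : a + n * L₀ - 1 = M := by omega
    simpa only [e] using h
  calc D ≤ (1 + C) * max (J M) 0 := hD
    _ ≤ (1 + C) * (max B 0 * θ ^ n) := mul_le_mul_of_nonneg_left hend (by linarith)
    _ = (1 + C) * max B 0 * θ ^ n := by ring

/-! ## The conditional reduction (bulk coherent-flux attenuation + contact bound) -/

/-- **`CoherentDephasing` from a bulk attenuation bound on the positive part of the incoming COHERENT flux and a
contact bound.** If for every admissible parameter point there are a block length `L₀ ≥ 1`, a head margin `L`, a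
contact depth `K`, a threshold `N₀`, a rate `κ > 0` and a constant `C ≥ 0` such that for every chain with `N ≥ N₀`
(i) across every BULK block of `L₀` consecutive sites `x, …, x+L₀-1` with `1 ≤ x`, `L ≤ x` and `x + L₀ + K ≤ N` the
coherent flux `J_b = cohFlux … N b` (full bond force) drops by at least `κ ×` the positive part of the incoming flux,
`κ max(J_{x-1}, 0) ≤ J_{x-1} - J_{x+L₀-1}`, and (ii) the far-bath dissipation `γ∫₀^∞ m_N²` is at most `(1+C) ×` the
positive part of the coherent flux `J_{N-K-1}` into the contact region, then the coherent channel closes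
(`CoherentDephasing`, by name). The head bound `J_b ≤ B` uniformly in `N, b` is the landed
`HeadBound.cohFlux_le_uniform`. [folklore] -/
theorem coherentDephasing_of_cohFluxAttenuation_of_contactBound :
    (∀ ω₂ lam β γ : ℝ, 0 < ω₂ → 0 < lam → 0 < β → 0 < γ → ∀ T : ℝ, 0 < T →
      ∃ L₀ L K N₀ : ℕ, ∃ κ C : ℝ, 0 < L₀ ∧ 0 < κ ∧ 0 ≤ C ∧
        (∀ N : ℕ, N₀ ≤ N → ∀ (x : ℕ) (hx : x + L₀ + K ≤ N) (h1 : 1 ≤ x), L ≤ x →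
          κ * max (cohFlux ω₂ lam β γ T N ⟨x - 1, by omega⟩) 0 ≤
            cohFlux ω₂ lam β γ T N ⟨x - 1, by omega⟩ - cohFlux ω₂ lam β γ T N ⟨x + L₀ - 1, by omega⟩) ∧
        (∀ (N : ℕ) (hN : K < N), N₀ ≤ N →
          γ * ∫ t in Set.Ioi (0 : ℝ), momResp ω₂ lam β γ T N (Fin.last N) t ^ 2 ≤
            (1 + C) * max (cohFlux ω₂ lam β γ T N ⟨N - K - 1, by omega⟩) 0)) →
    Summit.AtomisticToContinuum.FouriersLaw.Theses.PhononMeanFreePath.CoherentDephasing := by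
  intro hH ω₂ lam β γ hω hl hβ hγ T hT
  refine ⟨fun N => Summit.AtomisticToContinuum.FouriersLaw.Theorems.CoherentDephasing.pairCorr_sq_integrableOn
    hω hl.le hβ hγ hT N, ?_⟩
  obtain ⟨B, hBflux⟩ := cohFlux_le_uniform hω hl.le hβ hγ hT
  obtain ⟨L₀, L, K, N₀, κ, C, hL₀, hκ, hC, hatt, hcontact⟩ := hH ω₂ lam β γ hω hl hβ hγ T hT
  set D : ℕ → ℝ := fun N => γ * ∫ t in Ioi (0 : ℝ), momResp ω₂ lam β γ T N (Fin.last N) t ^ 2 with hD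
  set θ : ℝ := 1 - min κ 1 with hθ
  have hθ0 : 0 ≤ θ := by rw [hθ]; linarith [min_le_right κ 1]
  have hθ1 : θ < 1 := by rw [hθ]; linarith [lt_min hκ one_pos]
  -- head margin `L' = max L 1` (bulk blocks avoid site `0` as well)
  set L' : ℕ := max L 1 with hL'
  have hL'L : L ≤ L' := le_max_left L 1
  have hL'1 : 1 ≤ L' := le_max_right L 1
  have hI0 : ∀ N : ℕ, 0 ≤ ∫ t in Ioi (0 : ℝ), momResp ω₂ lam β γ T N (Fin.last N) t ^ 2 := fun N =>
    setIntegral_nonneg measurableSet_Ioi fun t _ => sq_nonneg _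
  have hgeo : ∀ N : ℕ, N₀ ≤ N → K + L' ≤ N → D N ≤ (1 + C) * max B 0 * θ ^ ((N - K - L') / L₀) := by
    intro N hN0 hN
    -- `n` blocks of `L₀` sites ending at the last bulk site `M = N - K - 1`, origin `a = N - K - nL₀ ≥ L'`
    set n : ℕ := (N - K - L') / L₀ with hn
    have hnL : n * L₀ ≤ N - K - L' := Nat.div_mul_le_self _ _
    -- `ℕ`-indexed coherent flux `J`, junk `0` out of range
    refine dissipation_le_geometric_posFluxDecrement
      (fun b => if h : b < N then cohFlux ω₂ lam β γ T N ⟨b, h⟩ else 0)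
      (D N) B κ C (N - K - 1) (N - K - n * L₀) L₀ n hκ hC (by omega) ?_ ?_ ?_
    · -- the bulk block attenuation bound (hypothesis (i)) at block start `x = a + jL₀`
      intro j hjn
      have hj1 : (j + 1) * L₀ ≤ n * L₀ := Nat.mul_le_mul_right L₀ hjn
      rw [Nat.succ_mul] at hj1
      have h := hatt N hN0 (N - K - n * L₀ + j * L₀) (by omega) (by omega) (by omega)
      rw [dif_pos (show N - K - n * L₀ + j * L₀ - 1 < N by omega),
        dif_pos (show N - K - n * L₀ + j * L₀ + L₀ - 1 < N by omega)]
      exact h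
    · -- head: the `N`-uniform coherent-flux bound at bond `a - 1`
      rw [dif_pos (show N - K - n * L₀ - 1 < N by omega)]
      exact hBflux N _
    · -- contact bound (hypothesis (ii)) at the last bulk bond `M = N - K - 1`
      rw [dif_pos (show N - K - 1 < N by omega)]
      exact hcontact N (by omega) hN0
  -- the exponent `(N - K - L')/L₀ = (N - (K + L'))/L₀`
  have hexp : ∀ N : ℕ, (N - K - L') / L₀ = (N - (K + L')) / L₀ := fun N => by rw [Nat.sub_sub]
  -- squeeze `0 ≤ N ∫ m_N² ≤ (N/γ)(1+C) max(B,0) θ^{…} → 0`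
  have hlim := (tendsto_natMul_pow_div θ hθ0 hθ1 L₀ hL₀ (K + L')).const_mul ((1 + C) * max B 0 / γ)
  rw [mul_zero] at hlim
  change Tendsto (fun N : ℕ => (N : ℝ) * ∫ t in Ioi (0 : ℝ), momResp ω₂ lam β γ T N (Fin.last N) t ^ 2) atTop (𝓝 0)
  refine squeeze_zero' (Eventually.of_forall fun N => mul_nonneg (Nat.cast_nonneg N) (hI0 N)) ?_ hlim
  filter_upwards [eventually_ge_atTop (max N₀ (K + L'))] with N hN
  have hN0 : N₀ ≤ N := le_of_max_le_left hN
  have hN1 : K + L' ≤ N := le_of_max_le_right hN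
  have h1 : (N : ℝ) * ∫ t in Ioi (0 : ℝ), momResp ω₂ lam β γ T N (Fin.last N) t ^ 2 = (N : ℝ) * (D N / γ) := by
    simp only [hD]; field_simp
  rw [h1]
  have h2 : D N / γ ≤ (1 + C) * max B 0 / γ * θ ^ ((N - (K + L')) / L₀) := by
    have := div_le_div_of_nonneg_right (hgeo N hN0 hN1) hγ.le
    rw [hexp N] at this
    calc D N / γ ≤ (1 + C) * max B 0 * θ ^ ((N - (K + L')) / L₀) / γ := this
      _ = (1 + C) * max B 0 / γ * θ ^ ((N - (K + L')) / L₀) := by ring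
  calc (N : ℝ) * (D N / γ) ≤ (N : ℝ) * ((1 + C) * max B 0 / γ * θ ^ ((N - (K + L')) / L₀)) :=
      mul_le_mul_of_nonneg_left h2 (Nat.cast_nonneg N)
    _ = (1 + C) * max B 0 / γ * ((N : ℝ) * θ ^ ((N - (K + L')) / L₀)) := by ring

end Summit.AtomisticToContinuum.FouriersLaw.Theorems.CoherentDephasing.CohFluxAttenuation

end
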